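import Mathlib
import Summits.MatrixMultiplication.MatrixMultiplication.Theses.SemilatticeSTPP
import Summits.MatrixMultiplication.MatrixMultiplication.Theorems.Thesis.Negative.SemilatticeSTPPVolumeFloor
import Literature.Computability.AlgebraicComplexity.GroupTheoreticMatMul
import Literature.Computability.AlgebraicComplexity.GroupTheoreticMatMulThmBProofs

/-!
# Line `registered` of crux `SemilatticeSTPP.Thesis` (stmt-MatrixMultiplication-5969):
# group hosts — a monoid-TPP family in a commutative GROUP is an STPP family (normal form),
# so bounded-exponent group hosts are uniformly obstructed (BCCGNSU 2017 Thm. B transferred)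

The thesis `X_M` of route `SemilatticeSTPP` (`Theses.SemilatticeSTPP.Thesis`) asks, for every `ε > 0`, for a finite
commutative monoid with every element regular and a MONOID-TPP family — coordinate maps `α ⟨i,(s,t)⟩`,
`β ⟨i,(t,u)⟩`, `γ ⟨i,(s,u)⟩` with `α x · β y = γ z ⟺` (the three block indices agree and the coordinates match),
indexed exactly like `matMulDirectSum` — with `|M| < Σᵢ (aᵢ bᵢ cᵢ)^((2+ε)/3)`.  When the host is a commutative
GROUP `G` such a family has a NORMAL FORM: on every non-degenerate block `i` (base points `s₀ = t₀ = u₀ = 0`),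
writing additively `P s := α(s,t₀)`, `R u := β(t₀,u)`, `q t := β(t₀,u₀) − β(t,u₀)`, the matched instances
`α(s,t) + β(t,u) = γ(s,u)` of the iff force

  `α(s,t) = P s + q t`,  `β(t,u) = R u − q t`,  `γ(s,u) = P s + R u`,

and the unmatched direction of the iff says precisely that the triples `(A i, B i, C i) := (P(Fin aᵢ), −q(Fin bᵢ),
−R(Fin cᵢ))` of finsets of `Additive G` satisfy the simultaneous triple product property of
Cohn–Kleinberg–Szegedy–Umans 2005, Def. 5.1 (tree predicate `Literature.Computability.AlgebraicComplexity.IsSTPP`,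
additive form): `(s' − s) + (t' − t) + (u' − u) = 0` with `s' = P^i σ'`, `s = P^k σ`, `t = −q^i τ`, `t' = −q^j τ'`,
`u = −R^j υ`, `u' = −R^k υ'` reads `α_i(σ',τ) + β_j(τ',υ) = γ_k(σ,υ')`.  The maps `P`, `q`, `R` are injective
(`alpha_injective_of_tpp`, `beta_injective_of_tpp` of `Theorems/Thesis/Negative/SemilatticeSTPPVolumeFloor.lean`),
so `|A i| |B i| |C i| = aᵢ bᵢ cᵢ`; degenerate blocks (`aᵢ bᵢ cᵢ = 0`) get empty triples.

* `isSTPP_of_tppFamily_commGroup` — the normal form: every monoid-TPP family (iff-form) in a commutative group `G`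
  yields an STPP family in `Additive G` with the same block volumes.
* `tppFamily_le_card_of_exponent_le` — consequently Blasiak–Church–Cohn–Grochow–Naslund–Sawin–Umans 2017 Thm. B
  (tree theorem `BlasiakChurchCohnGrochowNaslundSawinUmans2017_B_holds`, sorry-free) transfers verbatim to
  monoid-TPP families in commutative GROUP hosts of bounded exponent: for every `ℓ` there is `ε > 0` with
  `Σᵢ (aᵢ bᵢ cᵢ)^((2+ε)/3) ≤ |G|` whenever `Monoid.exponent G ≤ ℓ` — no witness of `Thesis` for small `ε` lives in
  such a host.

Mathlib + the four tree files above; sorry-free; no new definitions (the three finset families are existential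
witnesses).
-/

set_option linter.dupNamespace false
-- (single-conjunct summit: the namespace repeats `MatrixMultiplication`)

namespace Summit.MatrixMultiplication.MatrixMultiplication.Theorems.SemilatticeSTPPThesis

open Literature.Computability.AlgebraicComplexity
open Summit.MatrixMultiplication.MatrixMultiplication.Theorems.Thesis.Negative.SemilatticeSTPPVolumeFloor
  (alpha_injective_of_tpp beta_injective_of_tpp)

/-- **Group-host normal form.**  A monoid-TPP family (iff-form, `matMulDirectSum` indexing) whose host is a
commutative GROUP `G` is an STPP family (Cohn–Kleinberg–Szegedy–Umans 2005, Def. 5.1, additive form = tree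
`IsSTPP`) of finsets of `Additive G` with the same block volumes `|A i| |B i| |C i| = aᵢ bᵢ cᵢ`: on a non-degenerate
block `A i := {α(s,t₀)}ₛ`, `B i := {β(t,u₀) − β(t₀,u₀)}ₜ`, `C i := {−β(t₀,u)}ᵤ` (base points `t₀ = u₀ = 0`), on a
degenerate block `A i = B i = C i = ∅`.  [cite: CohnKleinbergSzegedyUmans2005, Def. 5.1] -/
theorem isSTPP_of_tppFamily_commGroup : ∀ (G : Type) [CommGroup G] (p : ℕ) (a b c : Fin p → ℕ)
    (α : (Σ i, Fin (a i) × Fin (b i)) → G) (β : (Σ i, Fin (b i) × Fin (c i)) → G)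
    (γ : (Σ i, Fin (a i) × Fin (c i)) → G),
    (∀ x y z, α x * β y = γ z ↔ (z.1 = x.1 ∧ x.1 = y.1 ∧ (z.2.1 : ℕ) = x.2.1 ∧ (x.2.2 : ℕ) = y.2.1 ∧
      (z.2.2 : ℕ) = y.2.2)) →
    ∃ (A B C : Fin p → Finset (Additive G)), Literature.Computability.AlgebraicComplexity.IsSTPP A B C ∧
      ∀ i, (A i).card * (B i).card * (C i).card = a i * b i * c i := by
  intro G _ p a b c α β γ h
  classical
  -- additive copies of the three coordinate maps
  obtain ⟨α', hα'⟩ : ∃ α' : (Σ i, Fin (a i) × Fin (b i)) → Additive G, ∀ x, α' x = Additive.ofMul (α x) :=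
    ⟨_, fun _ => rfl⟩
  obtain ⟨β', hβ'⟩ : ∃ β' : (Σ i, Fin (b i) × Fin (c i)) → Additive G, ∀ y, β' y = Additive.ofMul (β y) :=
    ⟨_, fun _ => rfl⟩
  obtain ⟨γ', hγ'⟩ : ∃ γ' : (Σ i, Fin (a i) × Fin (c i)) → Additive G, ∀ z, γ' z = Additive.ofMul (γ z) :=
    ⟨_, fun _ => rfl⟩
  have h' : ∀ x y z, α' x + β' y = γ' z ↔ (z.1 = x.1 ∧ x.1 = y.1 ∧ (z.2.1 : ℕ) = x.2.1 ∧
      (x.2.2 : ℕ) = y.2.1 ∧ (z.2.2 : ℕ) = y.2.2) := by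
    intro x y z
    rw [hα', hβ', hγ', ← ofMul_mul, Additive.ofMul.apply_eq_iff_eq]
    exact h x y z
  -- matched instances of the iff: `α(s,t) + β(t,u) = γ(s,u)` inside every block
  have hm : ∀ (i : Fin p) (s : Fin (a i)) (t : Fin (b i)) (u : Fin (c i)),
      α' ⟨i, (s, t)⟩ + β' ⟨i, (t, u)⟩ = γ' ⟨i, (s, u)⟩ :=
    fun i s t u => (h' _ _ _).2 ⟨rfl, rfl, rfl, rfl, rfl⟩
  -- NORMAL FORM on a non-degenerate block (base points `t₀ = 0`, `u₀ = 0`): with `P s := α(s,t₀)`,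
  -- `R u := β(t₀,u)`, `q t := β(t₀,u₀) - β(t,u₀)`:  `α(s,t) = P s + q t`, `β(t,u) = R u - q t`,
  -- `γ(s,u) = P s + R u`.
  have hαf : ∀ (i : Fin p) (hb : 0 < b i) (hc : 0 < c i) (s : Fin (a i)) (t : Fin (b i)),
      α' ⟨i, (s, t)⟩ =
        α' ⟨i, (s, ⟨0, hb⟩)⟩ + (β' ⟨i, (⟨0, hb⟩, ⟨0, hc⟩)⟩ - β' ⟨i, (t, ⟨0, hc⟩)⟩) := by
    intro i hb hc s t
    have e1 := hm i s t ⟨0, hc⟩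
    have e2 := hm i s ⟨0, hb⟩ ⟨0, hc⟩
    rw [← sub_eq_zero]
    have e : α' ⟨i, (s, t)⟩ - (α' ⟨i, (s, ⟨0, hb⟩)⟩ + (β' ⟨i, (⟨0, hb⟩, ⟨0, hc⟩)⟩ - β' ⟨i, (t, ⟨0, hc⟩)⟩))
        = (α' ⟨i, (s, t)⟩ + β' ⟨i, (t, ⟨0, hc⟩)⟩ - γ' ⟨i, (s, ⟨0, hc⟩)⟩)
          - (α' ⟨i, (s, ⟨0, hb⟩)⟩ + β' ⟨i, (⟨0, hb⟩, ⟨0, hc⟩)⟩ - γ' ⟨i, (s, ⟨0, hc⟩)⟩) := by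
      abel
    rw [e, e1, e2]
    simp only [sub_self]
  have hβf : ∀ (i : Fin p) (ha : 0 < a i) (hb : 0 < b i) (hc : 0 < c i) (t : Fin (b i)) (u : Fin (c i)),
      β' ⟨i, (t, u)⟩ =
        β' ⟨i, (⟨0, hb⟩, u)⟩ - (β' ⟨i, (⟨0, hb⟩, ⟨0, hc⟩)⟩ - β' ⟨i, (t, ⟨0, hc⟩)⟩) := by
    intro i ha hb hc t u
    have e1 := hm i ⟨0, ha⟩ t u
    have e2 := hm i ⟨0, ha⟩ ⟨0, hb⟩ u
    have e3 := hαf i hb hc ⟨0, ha⟩ t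
    rw [← sub_eq_zero] at e3 ⊢
    have e : β' ⟨i, (t, u)⟩ - (β' ⟨i, (⟨0, hb⟩, u)⟩ - (β' ⟨i, (⟨0, hb⟩, ⟨0, hc⟩)⟩ - β' ⟨i, (t, ⟨0, hc⟩)⟩))
        = (α' ⟨i, (⟨0, ha⟩, t)⟩ + β' ⟨i, (t, u)⟩ - γ' ⟨i, (⟨0, ha⟩, u)⟩)
          - (α' ⟨i, (⟨0, ha⟩, ⟨0, hb⟩)⟩ + β' ⟨i, (⟨0, hb⟩, u)⟩ - γ' ⟨i, (⟨0, ha⟩, u)⟩)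
          - (α' ⟨i, (⟨0, ha⟩, t)⟩ - (α' ⟨i, (⟨0, ha⟩, ⟨0, hb⟩)⟩
              + (β' ⟨i, (⟨0, hb⟩, ⟨0, hc⟩)⟩ - β' ⟨i, (t, ⟨0, hc⟩)⟩))) := by
      abel
    rw [e, e1, e2, e3]
    simp only [sub_self]
  have hγf : ∀ (i : Fin p) (hb : 0 < b i) (s : Fin (a i)) (u : Fin (c i)),
      γ' ⟨i, (s, u)⟩ = α' ⟨i, (s, ⟨0, hb⟩)⟩ + β' ⟨i, (⟨0, hb⟩, u)⟩ :=
    fun i hb s u => (hm i s ⟨0, hb⟩ u).symm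
  -- the three finset families: images of `P`, `-q`, `-R` on non-degenerate blocks, `∅` on degenerate ones
  obtain ⟨A, hA0, hA1⟩ : ∃ A : Fin p → Finset (Additive G),
      (∀ i, ¬ (0 < a i ∧ 0 < b i ∧ 0 < c i) → A i = ∅) ∧
      (∀ i, 0 < a i → ∀ hb : 0 < b i, 0 < c i →
        A i = Finset.univ.image (fun s : Fin (a i) => α' ⟨i, (s, ⟨0, hb⟩)⟩)) :=
    ⟨fun i => if hi : 0 < a i ∧ 0 < b i ∧ 0 < c i then
        Finset.univ.image (fun s : Fin (a i) => α' ⟨i, (s, ⟨0, hi.2.1⟩)⟩) else ∅,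
      fun i hi => dif_neg hi, fun i ha hb hc => dif_pos ⟨ha, hb, hc⟩⟩
  obtain ⟨B, hB0, hB1⟩ : ∃ B : Fin p → Finset (Additive G),
      (∀ i, ¬ (0 < a i ∧ 0 < b i ∧ 0 < c i) → B i = ∅) ∧
      (∀ i, 0 < a i → ∀ (hb : 0 < b i) (hc : 0 < c i),
        B i = Finset.univ.image (fun t : Fin (b i) =>
          β' ⟨i, (t, ⟨0, hc⟩)⟩ - β' ⟨i, (⟨0, hb⟩, ⟨0, hc⟩)⟩)) :=
    ⟨fun i => if hi : 0 < a i ∧ 0 < b i ∧ 0 < c i then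
        Finset.univ.image (fun t : Fin (b i) =>
          β' ⟨i, (t, ⟨0, hi.2.2⟩)⟩ - β' ⟨i, (⟨0, hi.2.1⟩, ⟨0, hi.2.2⟩)⟩) else ∅,
      fun i hi => dif_neg hi, fun i ha hb hc => dif_pos ⟨ha, hb, hc⟩⟩
  obtain ⟨C, hC0, hC1⟩ : ∃ C : Fin p → Finset (Additive G),
      (∀ i, ¬ (0 < a i ∧ 0 < b i ∧ 0 < c i) → C i = ∅) ∧
      (∀ i, 0 < a i → ∀ hb : 0 < b i, 0 < c i →
        C i = Finset.univ.image (fun u : Fin (c i) => -β' ⟨i, (⟨0, hb⟩, u)⟩)) :=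
    ⟨fun i => if hi : 0 < a i ∧ 0 < b i ∧ 0 < c i then
        Finset.univ.image (fun u : Fin (c i) => -β' ⟨i, (⟨0, hi.2.1⟩, u)⟩) else ∅,
      fun i hi => dif_neg hi, fun i ha hb hc => dif_pos ⟨ha, hb, hc⟩⟩
  -- membership: an element of `A i` / `B i` / `C i` certifies that block `i` is non-degenerate and is the
  -- image of a coordinate
  have hAmem : ∀ i S, S ∈ A i → ∃ (_ : 0 < a i) (hb : 0 < b i) (_ : 0 < c i) (s : Fin (a i)),
      S = α' ⟨i, (s, ⟨0, hb⟩)⟩ := by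
    intro i S hS
    by_cases hi : 0 < a i ∧ 0 < b i ∧ 0 < c i
    · rw [hA1 i hi.1 hi.2.1 hi.2.2, Finset.mem_image] at hS
      obtain ⟨s, -, rfl⟩ := hS
      exact ⟨hi.1, hi.2.1, hi.2.2, s, rfl⟩
    · rw [hA0 i hi] at hS
      simp at hS
  have hBmem : ∀ i T, T ∈ B i → ∃ (_ : 0 < a i) (hb : 0 < b i) (hc : 0 < c i) (t : Fin (b i)),
      T = β' ⟨i, (t, ⟨0, hc⟩)⟩ - β' ⟨i, (⟨0, hb⟩, ⟨0, hc⟩)⟩ := by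
    intro i T hT
    by_cases hi : 0 < a i ∧ 0 < b i ∧ 0 < c i
    · rw [hB1 i hi.1 hi.2.1 hi.2.2, Finset.mem_image] at hT
      obtain ⟨t, -, rfl⟩ := hT
      exact ⟨hi.1, hi.2.1, hi.2.2, t, rfl⟩
    · rw [hB0 i hi] at hT
      simp at hT
  have hCmem : ∀ i U, U ∈ C i → ∃ (_ : 0 < a i) (hb : 0 < b i) (_ : 0 < c i) (u : Fin (c i)),
      U = -β' ⟨i, (⟨0, hb⟩, u)⟩ := by
    intro i U hU
    by_cases hi : 0 < a i ∧ 0 < b i ∧ 0 < c i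
    · rw [hC1 i hi.1 hi.2.1 hi.2.2, Finset.mem_image] at hU
      obtain ⟨u, -, rfl⟩ := hU
      exact ⟨hi.1, hi.2.1, hi.2.2, u, rfl⟩
    · rw [hC0 i hi] at hU
      simp at hU
  refine ⟨A, B, C, ?_, ?_⟩
  · -- the STPP condition: back in `G` the hypothesis reads `α_i(σ',τ) · β_j(τ',υ) = γ_k(σ,υ')`
    intro i j k S hS S' hS' T hT T' hT' U hU U' hU' hsum
    obtain ⟨_, hbk, _, σ, rfl⟩ := hAmem k S hS
    obtain ⟨_, hbi, hci, σ', rfl⟩ := hAmem i S' hS'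
    obtain ⟨_, _, _, τ, rfl⟩ := hBmem i T hT
    obtain ⟨haj, hbj, hcj, τ', rfl⟩ := hBmem j T' hT'
    obtain ⟨_, _, _, υ, rfl⟩ := hCmem j U hU
    obtain ⟨_, _, _, υ', rfl⟩ := hCmem k U' hU'
    have key : α' ⟨i, (σ', τ)⟩ + β' ⟨j, (τ', υ)⟩ = γ' ⟨k, (σ, υ')⟩ := by
      rw [hαf i hbi hci σ' τ, hβf j haj hbj hcj τ' υ, hγf k hbk σ υ', ← sub_eq_zero, ← hsum]
      abel
    obtain ⟨h1, h2, h3, h4, h5⟩ := (h' _ _ _).1 key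
    simp only at h1 h2 h3 h4 h5
    subst h1 h2
    cases Fin.ext h3
    cases Fin.ext h4
    cases Fin.ext h5
    exact ⟨rfl, rfl, rfl, rfl, rfl⟩
  · -- volumes: `P`, `q`, `R` are injective on non-degenerate blocks; degenerate blocks have volume `0`
    intro i
    by_cases hi : 0 < a i ∧ 0 < b i ∧ 0 < c i
    · obtain ⟨ha, hb, hc⟩ := hi
      have hinjA : Function.Injective (fun s : Fin (a i) => α' ⟨i, (s, ⟨0, hb⟩)⟩) := by
        intro s s' he
        have he' : α ⟨i, (s, ⟨0, hb⟩)⟩ = α ⟨i, (s', ⟨0, hb⟩)⟩ := by simpa [hα'] using he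
        exact congrArg Prod.fst (eq_of_heq (Sigma.mk.inj_iff.mp
          (alpha_injective_of_tpp α β γ h ⟨i, (s, ⟨0, hb⟩)⟩ ⟨i, (s', ⟨0, hb⟩)⟩ hc he')).2)
      have hinjB : Function.Injective (fun t : Fin (b i) =>
          β' ⟨i, (t, ⟨0, hc⟩)⟩ - β' ⟨i, (⟨0, hb⟩, ⟨0, hc⟩)⟩) := by
        intro t t' he
        have he' : β ⟨i, (t, ⟨0, hc⟩)⟩ = β ⟨i, (t', ⟨0, hc⟩)⟩ := by
          simpa [hβ'] using sub_left_inj.mp he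
        exact congrArg Prod.fst (eq_of_heq (Sigma.mk.inj_iff.mp
          (beta_injective_of_tpp α β γ h ⟨i, (t, ⟨0, hc⟩)⟩ ⟨i, (t', ⟨0, hc⟩)⟩ ha he')).2)
      have hinjC : Function.Injective (fun u : Fin (c i) => -β' ⟨i, (⟨0, hb⟩, u)⟩) := by
        intro u u' he
        have he' : β ⟨i, (⟨0, hb⟩, u)⟩ = β ⟨i, (⟨0, hb⟩, u')⟩ := by
          simpa [hβ'] using neg_inj.mp he
        exact congrArg Prod.snd (eq_of_heq (Sigma.mk.inj_iff.mp
          (beta_injective_of_tpp α β γ h ⟨i, (⟨0, hb⟩, u)⟩ ⟨i, (⟨0, hb⟩, u')⟩ ha he')).2)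
      rw [hA1 i ha hb hc, hB1 i ha hb hc, hC1 i ha hb hc, Finset.card_image_of_injective _ hinjA,
        Finset.card_image_of_injective _ hinjB, Finset.card_image_of_injective _ hinjC]
      simp only [Finset.card_univ, Fintype.card_fin]
    · rw [hA0 i hi, hB0 i hi, hC0 i hi, Finset.card_empty]
      simp only [not_and_or, not_lt, Nat.le_zero] at hi
      rcases hi with h0 | h0 | h0 <;> simp [h0]

/-- **Bounded-exponent group hosts are uniformly obstructed** (Blasiak–Church–Cohn–Grochow–Naslund–Sawin–Umans
2017, Thm. B, transferred through the normal form `isSTPP_of_tppFamily_commGroup`): for every `ℓ` there is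
`ε > 0` such that every monoid-TPP family (iff-form) in a finite commutative GROUP `G` with `Monoid.exponent G ≤ ℓ`
has `Σᵢ (aᵢ bᵢ cᵢ)^((2+ε)/3) ≤ |G|`.  [cite: BlasiakChurchCohnGrochowNaslundSawinUmans2017, Thm. B] -/
theorem tppFamily_le_card_of_exponent_le : ∀ ℓ : ℕ, ∃ ε : ℝ, 0 < ε ∧ ∀ (G : Type) [CommGroup G] [Fintype G],
    Monoid.exponent G ≤ ℓ → ∀ (p : ℕ) (a b c : Fin p → ℕ) (α : (Σ i, Fin (a i) × Fin (b i)) → G)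
      (β : (Σ i, Fin (b i) × Fin (c i)) → G) (γ : (Σ i, Fin (a i) × Fin (c i)) → G),
      (∀ x y z, α x * β y = γ z ↔ (z.1 = x.1 ∧ x.1 = y.1 ∧ (z.2.1 : ℕ) = x.2.1 ∧ (x.2.2 : ℕ) = y.2.1 ∧
        (z.2.2 : ℕ) = y.2.2)) →
      ∑ i, ((a i * b i * c i : ℕ) : ℝ) ^ ((2 + ε) / 3) ≤ (Fintype.card G : ℝ) := by
  intro ℓ
  obtain ⟨ε, hε, hB⟩ := BlasiakChurchCohnGrochowNaslundSawinUmans2017_B_holds ℓ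
  refine ⟨ε, hε, ?_⟩
  intro G _ _ hexp p a b c α β γ h
  obtain ⟨A, B, C, hS, hvol⟩ := isSTPP_of_tppFamily_commGroup G p a b c α β γ h
  have hexp' : AddMonoid.exponent (Additive G) ≤ ℓ := by rwa [AddMonoid.exponent_additive]
  have key := hB (Additive G) hexp' p A B C hS
  rw [Fintype.card_additive] at key
  calc ∑ i, ((a i * b i * c i : ℕ) : ℝ) ^ ((2 + ε) / 3)
      = ∑ i, (((A i).card * (B i).card * (C i).card : ℕ) : ℝ) ^ ((2 + ε) / 3) :=
        Finset.sum_congr rfl fun i _ => by rw [hvol i]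
    _ ≤ (Fintype.card G : ℝ) := key

end Summit.MatrixMultiplication.MatrixMultiplication.Theorems.SemilatticeSTPPThesis
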